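import Literature.Analysis.PDE.DecayBootstrap
import HarnessLib

/-!
# A pointwise interior gradient bound for smooth solutions of `Δv = Dv[β] + c v` on `ℝ³`
# (tools for the rotating conjugate density, stub B2 of line `killing-twisted-bernoulli-solitons`,
# crux `Target`, stmt-NavierStokesRegularity-1217)

Helper file (all results proved, no definitions, no named facts). The Gaussian gradient bound of
the normalised rotating conjugate density `m = γ v` requires a pointwise bound on `∇v` in terms of
`sup v` on unit balls, with a constant polynomial in the local size of the (linearly growing)
drift. This file derives it from the tree's crude-constant interior `L²` theory on `ℝ³`
(`Literature.Analysis.PDE.ball_estimates_three_weak`, `level_zero_ball`, `level_one_ball` —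
Gilbarg–Trudinger Thms. 8.8, 8.10, 8.17 run for smooth functions, as in `DecayBootstrap.lean`):

* `sq_norm_fderiv_le_of_laplacian_eq`: there is an absolute constant `C_g` such that for smooth
  `v, β, c` on `ℝ³` with `Δv = Dv[β] + c v` everywhere and a point `y` with
  `|β| ≤ B`, `|c| ≤ B²`, `‖Dβ‖, ‖Dc‖ ≤ Λ`, `|v| ≤ S` on `B̄(y, 1)` (`B ≥ 1`, `Λ ≥ 0`):
  `‖Dv(y)‖² ≤ C_g (1 + Λ²) B⁶ S²`
  (scale `σ = M/(3B + M) ≤ 1` so that the drift is `≤ M/σ` on the ball; level zero on `B̄(y,σ)`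
  for `∫|∂v|², ∫|∂²v|²`, level one on `B̄(y,σ/2)` for `(∂ₘv(y))²`, and
  `‖Dv(y)‖² = Σₘ (∂ₘv(y))²`).

References: D. Gilbarg, N. S. Trudinger, *Elliptic partial differential equations of second
order* (2001), Thms. 8.8, 8.10, 8.17. [GilbargTrudinger2001]
-/

noncomputable section

set_option maxSynthPendingDepth 3

open MeasureTheory Set Filter Topology Real Metric InnerProductSpace
open scoped RealInnerProductSpace Laplacian ContDiff

namespace Summit.NavierStokesRegularity.NavierStokesRegularity.Theorems

open Literature.Analysis.PDE
open Literature.Geometry.Lorentzian (E3)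

/-- `‖Dv(y)‖² = Σₘ (∂ₘ v(y))²` in an orthonormal frame. [folklore] -/
theorem sq_norm_fderiv_eq_sum (b : OrthonormalBasis (Fin 3) ℝ E3) (v : E3 → ℝ) (y : E3) :
    ‖fderiv ℝ v y‖ ^ 2 = ∑ m, (fderiv ℝ v y (b m)) ^ 2 := by
  have h : ‖gradient v y‖ = ‖fderiv ℝ v y‖ := by
    rw [gradient, LinearIsometryEquiv.norm_map]
  rw [← h, ← real_inner_self_eq_norm_sq, ← b.sum_inner_mul_inner (gradient v y) (gradient v y)]
  refine Finset.sum_congr rfl fun m _ => ?_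
  rw [real_inner_comm (gradient v y) (b m), inner_gradient_left, sq]

/-- Arithmetic bookkeeping for the gradient bound, I. [folklore] -/
theorem grad_bookkeeping₁ {C0 Q Λ P I₁ I₂ : ℝ} (hC0 : 1 ≤ C0) (hQ1 : 1 ≤ Q) (hP0 : 0 ≤ P)
    (hI₁le : I₁ ≤ C0 * (Q ^ 2 * P)) (hI₂le : I₂ ≤ C0 * (Q ^ 4 * P)) :
    (2 * Q) ^ 4 * I₁ + 54 * Λ ^ 2 * (I₂ + I₁ + P) ≤ C0 * P * Q ^ 6 * (16 + 162 * Λ ^ 2) := by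
  have hQ2 : 1 ≤ Q ^ 2 := one_le_pow₀ hQ1
  have hQ4 : Q ^ 2 ≤ Q ^ 4 := pow_le_pow_right₀ hQ1 (by norm_num)
  have hQ46 : Q ^ 4 ≤ Q ^ 6 := pow_le_pow_right₀ hQ1 (by norm_num)
  have hQ40 : 0 ≤ 16 * Q ^ 4 := by positivity
  have e1 : (2 * Q) ^ 4 * I₁ ≤ 16 * Q ^ 4 * (C0 * (Q ^ 2 * P)) := by
    rw [show (2 * Q) ^ 4 = 16 * Q ^ 4 by ring]; exact mul_le_mul_of_nonneg_left hI₁le hQ40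
  have hCQ : 1 ≤ C0 * Q ^ 2 := by nlinarith
  have hP1 : P ≤ C0 * (Q ^ 2 * P) := by
    have : 1 * P ≤ (C0 * Q ^ 2) * P := mul_le_mul_of_nonneg_right hCQ hP0
    linarith
  have e2 : I₂ + I₁ + P ≤ C0 * (Q ^ 4 * P) + C0 * (Q ^ 2 * P) + C0 * (Q ^ 2 * P) := by linarith
  have hC0' : 0 ≤ C0 := by linarith
  have t4 : C0 * (Q ^ 4 * P) ≤ C0 * (Q ^ 6 * P) :=
    mul_le_mul_of_nonneg_left (mul_le_mul_of_nonneg_right hQ46 hP0) hC0'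
  have t2 : C0 * (Q ^ 2 * P) ≤ C0 * (Q ^ 6 * P) :=
    mul_le_mul_of_nonneg_left (mul_le_mul_of_nonneg_right (hQ4.trans hQ46) hP0) hC0'
  have e3 : C0 * (Q ^ 4 * P) + C0 * (Q ^ 2 * P) + C0 * (Q ^ 2 * P) ≤ 3 * (C0 * (Q ^ 6 * P)) := by linarith
  have e4 : 54 * Λ ^ 2 * (I₂ + I₁ + P) ≤ 54 * Λ ^ 2 * (3 * (C0 * (Q ^ 6 * P))) :=
    mul_le_mul_of_nonneg_left (e2.trans e3) (by positivity)
  calc (2 * Q) ^ 4 * I₁ + 54 * Λ ^ 2 * (I₂ + I₁ + P)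
      ≤ 16 * Q ^ 4 * (C0 * (Q ^ 2 * P)) + 54 * Λ ^ 2 * (3 * (C0 * (Q ^ 6 * P))) := add_le_add e1 e4
    _ = C0 * P * Q ^ 6 * (16 + 162 * Λ ^ 2) := by ring

/-- Arithmetic bookkeeping for the gradient bound, II. [folklore] -/
theorem grad_bookkeeping₂ {C0 P Q Λ V S B M : ℝ} (hC0 : 1 ≤ C0) (hQ0 : 0 ≤ Q) (hV : 0 ≤ V) (hPS : P ≤ V * S ^ 2)
    (hQ6 : Q ^ 6 ≤ (3 + M) ^ 6 * B ^ 6) (hMB : 0 ≤ (3 + M) ^ 6 * B ^ 6) :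
    C0 * (1 / 2) * (C0 * P * Q ^ 6 * (16 + 162 * Λ ^ 2)) ≤
      81 * C0 ^ 2 * V * (3 + M) ^ 6 * ((1 + Λ ^ 2) * B ^ 6 * S ^ 2) := by
  have hC0' : 0 ≤ C0 := by linarith
  have hΛ : 0 ≤ Λ ^ 2 := sq_nonneg _
  have hVS : 0 ≤ V * S ^ 2 := mul_nonneg hV (sq_nonneg _)
  have t1 : C0 * P * Q ^ 6 ≤ C0 * (V * S ^ 2) * ((3 + M) ^ 6 * B ^ 6) :=
    mul_le_mul (mul_le_mul_of_nonneg_left hPS hC0') hQ6 (pow_nonneg hQ0 6) (mul_nonneg hC0' hVS)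
  have t2 : C0 * P * Q ^ 6 * (16 + 162 * Λ ^ 2) ≤ C0 * (V * S ^ 2) * ((3 + M) ^ 6 * B ^ 6) * (162 * (1 + Λ ^ 2)) :=
    mul_le_mul t1 (by linarith) (by positivity) (mul_nonneg (mul_nonneg hC0' hVS) hMB)
  calc C0 * (1 / 2) * (C0 * P * Q ^ 6 * (16 + 162 * Λ ^ 2))
      ≤ C0 * (1 / 2) * (C0 * (V * S ^ 2) * ((3 + M) ^ 6 * B ^ 6) * (162 * (1 + Λ ^ 2))) :=
        mul_le_mul_of_nonneg_left t2 (by positivity)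
    _ = 81 * C0 ^ 2 * V * (3 + M) ^ 6 * ((1 + Λ ^ 2) * B ^ 6 * S ^ 2) := by ring

/-- **Pointwise interior gradient bound.** An absolute constant `C_g > 0` such that for smooth
`v, β, c : ℝ³ → ·` with `Δv = Dv[β] + c v` on `ℝ³`, a point `y`, and bounds `|β| ≤ B`, `|c| ≤ B²`,
`‖Dβ‖ ≤ Λ`, `‖Dc‖ ≤ Λ`, `|v| ≤ S` on `B̄(y, 1)` (`1 ≤ B`, `0 ≤ Λ`):
`‖Dv(y)‖² ≤ C_g (1 + Λ²) B⁶ S²`. [cite: GilbargTrudinger2001, Thm. 8.10 and Thm. 8.17 (classical case)] -/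
theorem sq_norm_fderiv_le_of_laplacian_eq :
    ∃ Cg : ℝ, 0 < Cg ∧ ∀ (v : E3 → ℝ) (βv : E3 → E3) (c : E3 → ℝ) (y : E3) (B Λ S : ℝ),
      ContDiff ℝ ∞ v → ContDiff ℝ ∞ βv → ContDiff ℝ ∞ c →
      (∀ z, (Δ v) z = fderiv ℝ v z (βv z) + c z * v z) →
      1 ≤ B → 0 ≤ Λ →
      (∀ z ∈ closedBall y 1, ‖βv z‖ ≤ B) → (∀ z ∈ closedBall y 1, |c z| ≤ B ^ 2) →
      (∀ z ∈ closedBall y 1, ‖fderiv ℝ βv z‖ ≤ Λ) → (∀ z ∈ closedBall y 1, ‖fderiv ℝ c z‖ ≤ Λ) →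
      (∀ z ∈ closedBall y 1, |v z| ≤ S) →
      ‖fderiv ℝ v y‖ ^ 2 ≤ Cg * (1 + Λ ^ 2) * B ^ 6 * S ^ 2 := by
  classical
  set b : OrthonormalBasis (Fin 3) ℝ E3 := EuclideanSpace.basisFun (Fin 3) ℝ with hb
  obtain ⟨M, C0, hM1, hC1, hMC⟩ := ball_estimates_three_weak b
  have hM : 0 < M := by linarith
  have hC0 : 0 ≤ C0 := by linarith
  set V : ℝ := (volume (closedBall (0 : E3) 1)).toReal with hV
  have hV0 : 0 ≤ V := ENNReal.toReal_nonneg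
  refine ⟨3 * (81 * C0 ^ 2 * V * (3 + M) ^ 6) + 1, by positivity, ?_⟩
  intro v βv c y B Λ S hv hβv hc hΔ hB hΛ0 hβB hcB hβΛ hcΛ hvS
  have hbn : ∀ i, ‖b i‖ = 1 := fun i => b.orthonormal.1 i
  clear_value V b
  -- the scale
  set Q : ℝ := 3 * B + M with hQ
  have hQ1 : 1 ≤ Q := by rw [hQ]; linarith
  have hQM : M ≤ Q := by rw [hQ]; linarith
  have hQpos : 0 < Q := by linarith
  set σ₁ : ℝ := M / (2 * Q) with hσ₁
  have hσ₁pos : 0 < σ₁ := by positivity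
  set σ : ℝ := 2 * σ₁ with hσdef
  have hσpos : 0 < σ := by positivity
  have hσQ : M / σ = Q := by rw [hσdef, hσ₁]; field_simp
  have hσ₁Q : M / σ₁ = 2 * Q := by rw [hσ₁]; field_simp
  have hσ1 : σ ≤ 1 := by
    rw [hσdef, hσ₁, show 2 * (M / (2 * Q)) = M / Q by field_simp]; exact (div_le_one hQpos).2 hQM
  have hσ₁σ : σ₁ ≤ σ := by rw [hσdef]; linarith
  have hsub1 : closedBall y σ ⊆ closedBall y 1 := closedBall_subset_closedBall hσ1
  have hsub₁ : closedBall y σ₁ ⊆ closedBall y σ := closedBall_subset_closedBall hσ₁σ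
  -- the equation in coordinates
  set a : Fin 3 → Fin 3 → E3 → ℝ := fun k l _ => if k = l then 1 else 0 with ha
  set β : Fin 3 → E3 → ℝ := fun k z => -⟪b k, βv z⟫ with hβdef
  set c' : E3 → ℝ := fun z => -c z with hc'
  set g : E3 → ℝ := fun _ => 0 with hgdef
  have hg : ContDiffOn ℝ ∞ g univ := contDiffOn_const
  have hv2 : ∀ z, ContDiffAt ℝ 2 v z := fun z => (hv.of_le (by norm_cast)).contDiffAt
  have heq : ∀ z ∈ (univ : Set E3), ∑ k, ∑ l, a k l z * fderiv ℝ (fun z' => fderiv ℝ v z' (b k)) z (b l)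
      + ∑ k, β k z * fderiv ℝ v z (b k) + c' z * v z = g z := by
    intro z _
    have h1 : ∑ k, ∑ l, a k l z * fderiv ℝ (fun z' => fderiv ℝ v z' (b k)) z (b l) = (Δ v) z := by
      rw [laplacian_eq_sum_of_contDiffAt b (hv2 z)]
      refine Finset.sum_congr rfl fun k _ => ?_
      simp only [ha, ite_mul, one_mul, zero_mul, Finset.sum_ite_eq, Finset.mem_univ, if_true]
    have h2 : ∑ k, β k z * fderiv ℝ v z (b k) = -fderiv ℝ v z (βv z) := by
      have e : ∑ k, ⟪b k, βv z⟫ * fderiv ℝ v z (b k) = fderiv ℝ v z (∑ k, ⟪b k, βv z⟫ • b k) := by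
        rw [map_sum]
        refine Finset.sum_congr rfl fun k _ => ?_
        rw [map_smul, smul_eq_mul]
      rw [b.sum_repr' (βv z)] at e
      simp only [hβdef, neg_mul, Finset.sum_neg_distrib, e]
    rw [h1, h2, hΔ z]
    simp only [hc', hgdef]
    ring
  have has : ∀ k l, ContDiffOn ℝ ∞ (a k l) univ := fun k l => contDiffOn_const
  have hβs : ∀ k, ContDiffOn ℝ ∞ (β k) univ := fun k =>
    (contDiff_const.inner ℝ hβv).neg.contDiffOn
  have hcs : ContDiffOn ℝ ∞ c' univ := hc.neg.contDiffOn
  have haε : ∀ r, ∀ z ∈ closedBall y r, ∑ k, ∑ l, |a k l z - if k = l then 1 else 0| ≤ (0 : ℝ) := by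
    intro r z _
    simp [ha]
  -- coefficient bounds on `B̄(y, 1)`
  have hβsum : ∀ z ∈ closedBall y 1, ∑ k, |β k z| ≤ 3 * B := by
    intro z hz
    have h1 : ∀ k, |β k z| ≤ B := fun k => by
      simp only [hβdef, abs_neg]
      calc |⟪b k, βv z⟫| ≤ ‖b k‖ * ‖βv z‖ := abs_real_inner_le_norm _ _
        _ ≤ B := by rw [hbn k, one_mul]; exact hβB z hz
    calc ∑ k, |β k z| ≤ ∑ _k : Fin 3, B := Finset.sum_le_sum fun k _ => h1 k
      _ = 3 * B := by simp
  have hc'B : ∀ z ∈ closedBall y 1, |c' z| ≤ B ^ 2 := fun z hz => by simp only [hc', abs_neg]; exact hcB z hz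
  have hΛ1 : ∀ z ∈ closedBall y 1, ∀ i, (∀ k l, |fderiv ℝ (a k l) z (b i)| ≤ Λ) ∧
      (∀ k, |fderiv ℝ (β k) z (b i)| ≤ Λ) ∧ |fderiv ℝ c' z (b i)| ≤ Λ := by
    intro z hz i
    refine ⟨fun k l => by simp [ha, hΛ0], fun k => ?_, ?_⟩
    · have hd : DifferentiableAt ℝ βv z := (hβv.differentiable (by simp)) z
      have e : fderiv ℝ (β k) z (b i) = -⟪b k, fderiv ℝ βv z (b i)⟫ := by
        simp only [hβdef]
        rw [fderiv_fun_neg, _root_.neg_apply,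
          fderiv_inner_apply ℝ (differentiableAt_const _) hd, fderiv_fun_const, Pi.zero_apply,
          _root_.zero_apply, inner_zero_left, add_zero]
      rw [e, abs_neg]
      calc |⟪b k, fderiv ℝ βv z (b i)⟫| ≤ ‖b k‖ * ‖fderiv ℝ βv z (b i)‖ := abs_real_inner_le_norm _ _
        _ ≤ 1 * (‖fderiv ℝ βv z‖ * ‖b i‖) := by rw [hbn k]; exact mul_le_mul_of_nonneg_left (ContinuousLinearMap.le_opNorm _ _) zero_le_one
        _ ≤ Λ := by rw [hbn i, one_mul, mul_one]; exact hβΛ z hz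
    · have hd : DifferentiableAt ℝ c z := (hc.differentiable (by simp)) z
      simp only [hc']
      rw [fderiv_fun_neg, _root_.neg_apply, abs_neg]
      calc |fderiv ℝ c z (b i)| = ‖fderiv ℝ c z (b i)‖ := (Real.norm_eq_abs _).symm
        _ ≤ ‖fderiv ℝ c z‖ * ‖b i‖ := ContinuousLinearMap.le_opNorm _ _
        _ ≤ Λ := by rw [hbn i, mul_one]; exact hcΛ z hz
  -- level zero on `B̄(y, σ)`
  have hβσ : ∀ z ∈ closedBall y σ, ∑ k, |β k z| ≤ M / σ := fun z hz => by
    rw [hσQ]; exact (hβsum z (hsub1 hz)).trans (by rw [hQ]; linarith)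
  have hcσ : ∀ z ∈ closedBall y σ, |c' z| ≤ (M / σ) ^ 2 := fun z hz => by
    rw [hσQ]; exact (hc'B z (hsub1 hz)).trans (by nlinarith)
  obtain ⟨hI₁, hI₂, -⟩ := level_zero_ball (b := b) hMC isOpen_univ hσpos (subset_univ _) hv.contDiffOn
    hg (ε := 0) le_rfl (by norm_num) heq (haε σ) hβσ hcσ
  -- level one on `B̄(y, σ₁)`
  have hβσ₁ : ∀ z ∈ closedBall y σ₁, ∑ k, |β k z| ≤ M / σ₁ := fun z hz => by
    rw [hσ₁Q]; exact (hβsum z (hsub1 (hsub₁ hz))).trans (by rw [hQ]; linarith)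
  have hcσ₁ : ∀ z ∈ closedBall y σ₁, |c' z| ≤ (M / σ₁) ^ 2 := fun z hz => by
    rw [hσ₁Q]; exact (hc'B z (hsub1 (hsub₁ hz))).trans (by nlinarith)
  have hΛσ₁ : ∀ z ∈ closedBall y σ₁, ∀ i, (∀ k l, |fderiv ℝ (a k l) z (b i)| ≤ Λ) ∧
      (∀ k, |fderiv ℝ (β k) z (b i)| ≤ Λ) ∧ |fderiv ℝ c' z (b i)| ≤ Λ := fun z hz => hΛ1 z (hsub1 (hsub₁ hz))
  have hone := fun m => (level_one_ball (b := b) hC0 hM hMC isOpen_univ hσ₁pos (subset_univ _) hv.contDiffOn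
    hg has hβs hcs (ε := 0) le_rfl (by norm_num) heq (haε σ₁) hβσ₁ hcσ₁ hΛσ₁ m).2.2 y
    (mem_closedBall_self (by positivity))
  clear hMC heq has hβs hcs haε hΛ1 hΛσ₁ hβσ hcσ hβσ₁ hcσ₁ hβsum hc'B
  -- bookkeeping
  set P : ℝ := ∫ z in closedBall y σ, v z ^ 2 with hP
  have hP0 : 0 ≤ P := setIntegral_nonneg measurableSet_closedBall fun z _ => sq_nonneg _
  have hPS : P ≤ V * S ^ 2 := by
    have hvol : (volume (closedBall y σ)).toReal ≤ V := by
      rw [hV, ← Measure.addHaar_closedBall_center volume y 1]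
      exact ENNReal.toReal_mono measure_closedBall_lt_top.ne (measure_mono hsub1)
    calc P ≤ ∫ _ in closedBall y σ, S ^ 2 := by
          refine setIntegral_mono_on ((hv.continuous.pow 2).continuousOn.integrableOn_compact (isCompact_closedBall _ _))
            (integrableOn_const measure_closedBall_lt_top.ne) measurableSet_closedBall fun z hz => ?_
          have := hvS z (hsub1 hz)
          rw [← sq_abs]; exact pow_le_pow_left₀ (abs_nonneg _) this 2
      _ = S ^ 2 * (volume (closedBall y σ)).toReal := by rw [setIntegral_const, smul_eq_mul, mul_comm]; rfl
      _ ≤ S ^ 2 * V := mul_le_mul_of_nonneg_left hvol (sq_nonneg _)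
      _ = V * S ^ 2 := mul_comm _ _
  set I₁ : ℝ := ∫ z in ball y (σ / 2), ∑ i, (fderiv ℝ v z (b i)) ^ 2 with hI₁def
  set I₂ : ℝ := ∫ z in ball y (σ / 2), ∑ i, ∑ j, (fderiv ℝ (fun w => fderiv ℝ v w (b i)) z (b j)) ^ 2 with hI₂def
  have hg0 : ∫ z in closedBall y σ, g z ^ 2 = 0 := by simp [hgdef]
  rw [hg0] at hI₁ hI₂
  have hI₁le : I₁ ≤ C0 * (Q ^ 2 * P) := by
    have := hI₁; rw [hσQ, zero_div, add_zero] at this; exact this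
  have hI₂le : I₂ ≤ C0 * (Q ^ 4 * P) := by
    have := hI₂; rw [hσQ, add_zero] at this; exact this
  have hσhalf : σ / 2 = σ₁ := by rw [hσdef]; ring
  -- continuity of the integrands
  have hcont1 : Continuous fun z => ∑ i, (fderiv ℝ v z (b i)) ^ 2 :=
    continuous_finsetSum _ fun i _ => ((hv.continuous_fderiv (by simp)).clm_apply continuous_const).pow 2
  have hcd : ∀ i, ContDiff ℝ ∞ (fun w => fderiv ℝ v w (b i)) := fun i =>
    (hv.fderiv_right (m := ∞) (by norm_cast)).clm_apply contDiff_const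
  have hcont2 : Continuous fun z => ∑ i, ∑ j, (fderiv ℝ (fun w => fderiv ℝ v w (b i)) z (b j)) ^ 2 :=
    continuous_finsetSum _ fun i _ => continuous_finsetSum _ fun j _ =>
      (((hcd i).continuous_fderiv (by simp)).clm_apply continuous_const).pow 2
  have hI₁0 : 0 ≤ I₁ := setIntegral_nonneg measurableSet_ball fun z _ => Finset.sum_nonneg fun i _ => sq_nonneg _
  have hI₂0 : 0 ≤ I₂ := setIntegral_nonneg measurableSet_ball fun z _ =>
    Finset.sum_nonneg fun i _ => Finset.sum_nonneg fun j _ => sq_nonneg _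
  -- the three integrals of level one, over `B̄(y, σ₁) = B(y, σ/2)` a.e.
  have hJ₁ : ∀ m, ∫ z in closedBall y σ₁, (fderiv ℝ v z (b m)) ^ 2 ≤ I₁ := by
    intro m
    rw [setIntegral_closedBall_eq_ball, ← hσhalf]
    refine setIntegral_mono_on (((hv.continuous_fderiv (by simp)).clm_apply continuous_const).pow 2
      |>.continuousOn.integrableOn_compact (isCompact_closedBall y (σ / 2)) |>.mono_set ball_subset_closedBall)
      (hcont1.continuousOn.integrableOn_compact (isCompact_closedBall y (σ / 2)) |>.mono_set ball_subset_closedBall)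
      measurableSet_ball fun z _ => ?_
    exact Finset.single_le_sum (f := fun i => (fderiv ℝ v z (b i)) ^ 2) (fun i _ => sq_nonneg _) (Finset.mem_univ m)
  have hJ₂ : ∫ z in closedBall y σ₁, (∑ i, ∑ j, (fderiv ℝ (fun w => fderiv ℝ v w (b i)) z (b j)) ^ 2
      + ∑ i, (fderiv ℝ v z (b i)) ^ 2 + v z ^ 2) ≤ I₂ + I₁ + P := by
    rw [setIntegral_closedBall_eq_ball, ← hσhalf]
    have i2 : IntegrableOn (fun z => ∑ i, ∑ j, (fderiv ℝ (fun w => fderiv ℝ v w (b i)) z (b j)) ^ 2) (ball y (σ / 2)) :=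
      (hcont2.continuousOn.integrableOn_compact (isCompact_closedBall y (σ / 2))).mono_set ball_subset_closedBall
    have i1 : IntegrableOn (fun z => ∑ i, (fderiv ℝ v z (b i)) ^ 2) (ball y (σ / 2)) :=
      (hcont1.continuousOn.integrableOn_compact (isCompact_closedBall y (σ / 2))).mono_set ball_subset_closedBall
    have i0 : IntegrableOn (fun z => v z ^ 2) (ball y (σ / 2)) :=
      ((hv.continuous.pow 2).continuousOn.integrableOn_compact (isCompact_closedBall y (σ / 2))).mono_set ball_subset_closedBall
    have i21 : IntegrableOn (fun z => ∑ i, ∑ j, (fderiv ℝ (fun w => fderiv ℝ v w (b i)) z (b j)) ^ 2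
        + ∑ i, (fderiv ℝ v z (b i)) ^ 2) (ball y (σ / 2)) := i2.add i1
    rw [integral_add i21 i0, integral_add i2 i1]
    have hP' : ∫ z in ball y (σ / 2), v z ^ 2 ≤ P := by
      refine setIntegral_mono_set ((hv.continuous.pow 2).continuousOn.integrableOn_compact (isCompact_closedBall _ _))
        (Eventually.of_forall fun z => sq_nonneg _) (Eventually.of_forall ?_)
      exact fun z hz => ball_subset_closedBall (ball_subset_ball (by linarith) hz)
    linarith
  have hg1 : ∀ m, ∫ z in closedBall y σ₁, (fderiv ℝ g z (b m)) ^ 2 = 0 := fun m => by simp [hgdef]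
  simp only [hg1] at hone
  clear_value I₁ I₂ P
  clear hI₁ hI₂ hg0 hg1 hcont1 hcont2 hcd
  -- the pointwise bound for each partial derivative
  have hQ4pos : 0 ≤ (2 * Q) ^ 4 := by positivity
  have hQ6 : Q ^ 6 ≤ (3 + M) ^ 6 * B ^ 6 := by
    rw [← mul_pow]
    refine pow_le_pow_left₀ hQpos.le ?_ 6
    rw [hQ]; nlinarith [mul_nonneg hM.le (sub_nonneg.2 hB)]
  have hMB : 0 ≤ (3 + M) ^ 6 * B ^ 6 := by positivity
  have hσ₁le : σ₁ ≤ 1 / 2 := by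
    rw [hσ₁, div_le_iff₀ (by positivity)]; linarith
  have hCσ : 0 ≤ C0 * σ₁ := by positivity
  have hCσ' : C0 * σ₁ ≤ C0 * (1 / 2) := mul_le_mul_of_nonneg_left hσ₁le hC0
  have hsum0 : 0 ≤ I₂ + I₁ + P := add_nonneg (add_nonneg hI₂0 hI₁0) hP0
  have step2 := grad_bookkeeping₁ (Λ := Λ) hC1 hQ1 hP0 hI₁le hI₂le
  have step3 := grad_bookkeeping₂ (Λ := Λ) hC1 hQpos.le hV0 hPS hQ6 hMB
  clear_value Q σ σ₁
  have hX0 : 0 ≤ (2 * Q) ^ 4 * I₁ + 54 * Λ ^ 2 * (I₂ + I₁ + P) :=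
    add_nonneg (mul_nonneg hQ4pos hI₁0) (mul_nonneg (by positivity) hsum0)
  have hpt : ∀ m, (fderiv ℝ v y (b m)) ^ 2 ≤ 81 * C0 ^ 2 * V * (3 + M) ^ 6 * ((1 + Λ ^ 2) * B ^ 6 * S ^ 2) := by
    intro m
    have h1 := hone m
    rw [hσ₁Q, mul_zero, zero_add] at h1
    have hA := mul_le_mul_of_nonneg_left (hJ₁ m) hQ4pos
    have hBB := mul_le_mul_of_nonneg_left hJ₂ (by positivity : (0 : ℝ) ≤ 54 * Λ ^ 2)
    have h2 := add_le_add hA hBB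
    calc (fderiv ℝ v y (b m)) ^ 2 ≤ _ := h1
      _ ≤ C0 * σ₁ * ((2 * Q) ^ 4 * I₁ + 54 * Λ ^ 2 * (I₂ + I₁ + P)) := mul_le_mul_of_nonneg_left h2 hCσ
      _ ≤ C0 * (1 / 2) * ((2 * Q) ^ 4 * I₁ + 54 * Λ ^ 2 * (I₂ + I₁ + P)) := mul_le_mul_of_nonneg_right hCσ' hX0
      _ ≤ C0 * (1 / 2) * (C0 * P * Q ^ 6 * (16 + 162 * Λ ^ 2)) := mul_le_mul_of_nonneg_left step2 (by positivity)
      _ ≤ 81 * C0 ^ 2 * V * (3 + M) ^ 6 * ((1 + Λ ^ 2) * B ^ 6 * S ^ 2) := step3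
  rw [sq_norm_fderiv_eq_sum b]
  have h0 : 0 ≤ (1 + Λ ^ 2) * B ^ 6 * S ^ 2 := by positivity
  have hK0 : 0 ≤ 81 * C0 ^ 2 * V * (3 + M) ^ 6 := by positivity
  calc ∑ m, (fderiv ℝ v y (b m)) ^ 2 ≤ ∑ _m : Fin 3, 81 * C0 ^ 2 * V * (3 + M) ^ 6 * ((1 + Λ ^ 2) * B ^ 6 * S ^ 2) :=
        Finset.sum_le_sum fun m _ => hpt m
    _ = 3 * (81 * C0 ^ 2 * V * (3 + M) ^ 6) * ((1 + Λ ^ 2) * B ^ 6 * S ^ 2) := by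
        rw [Finset.sum_const, Finset.card_univ, Fintype.card_fin, nsmul_eq_mul]; push_cast; ring
    _ ≤ (3 * (81 * C0 ^ 2 * V * (3 + M) ^ 6) + 1) * ((1 + Λ ^ 2) * B ^ 6 * S ^ 2) :=
        mul_le_mul_of_nonneg_right (by linarith) h0
    _ = (3 * (81 * C0 ^ 2 * V * (3 + M) ^ 6) + 1) * (1 + Λ ^ 2) * B ^ 6 * S ^ 2 := by ring

/-- **Registered form (B2 tool stub `rotatingDensity_gradientEstimate`).** The pointwise interior
gradient bound `‖Dv(y)‖² ≤ C_g (1 + Λ²) B⁶ S²` for smooth solutions of `Δv = Dv[β] + c v` on `ℝ³`.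
[cite: GilbargTrudinger2001, Thm. 8.10 and Thm. 8.17 (classical case)] -/
theorem rotatingDensity_gradientEstimate :
    ∃ Cg : ℝ, 0 < Cg ∧ ∀ (v : EuclideanSpace ℝ (Fin 3) → ℝ) (βv : EuclideanSpace ℝ (Fin 3) → EuclideanSpace ℝ (Fin 3)) (c : EuclideanSpace ℝ (Fin 3) → ℝ) (y : EuclideanSpace ℝ (Fin 3)) (B Λ S : ℝ), ContDiff ℝ (⊤ : ℕ∞) v → ContDiff ℝ (⊤ : ℕ∞) βv → ContDiff ℝ (⊤ : ℕ∞) c → (∀ z, Laplacian.laplacian v z = fderiv ℝ v z (βv z) + c z * v z) → 1 ≤ B → 0 ≤ Λ → (∀ z ∈ Metric.closedBall y 1, ‖βv z‖ ≤ B) → (∀ z ∈ Metric.closedBall y 1, |c z| ≤ B ^ 2) → (∀ z ∈ Metric.closedBall y 1, ‖fderiv ℝ βv z‖ ≤ Λ) → (∀ z ∈ Metric.closedBall y 1, ‖fderiv ℝ c z‖ ≤ Λ) → (∀ z ∈ Metric.closedBall y 1, |v z| ≤ S) → ‖fderiv ℝ v y‖ ^ 2 ≤ Cg * (1 + Λ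 ^ 2) * B ^ 6 * S ^ 2 :=
  sq_norm_fderiv_le_of_laplacian_eq

end Summit.NavierStokesRegularity.NavierStokesRegularity.Theorems
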